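import Summits.HodgeConjecture.HodgeConjecture.Theses.NodalSupport
import Literature.AlgebraicGeometry.HodgeTheory.ComplexConjugationHolds

/-!
# Route NodalSupport — `HodgeModels` (shared support item stmt-HodgeConjecture-1943), `NodalSupport` copy

The support item `HodgeModels` — `∀ n X, Literature.AlgebraicGeometry.HodgeTheory.nonempty_hodgeModel n X`
(every smooth projective complex variety of dimension `n` has a Hodge model: Serre's
analytification, de Rham's theorem, the Hodge decomposition of the compact Kähler manifold `X^an`) —
is one ledger item (stmt-HodgeConjecture-1943) wanted with the identical statement by nine routes of
the summit.  This file records the one-line proof against the `NodalSupport` copy of the decl, so that this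
route's deciding theorem can be fed `HodgeModels` by name: the named fact is discharged in the
Literature library by `Literature.AlgebraicGeometry.HodgeTheory.nonempty_hodgeModel_holds`
(`HodgeTheory/ComplexConjugationHolds`, relying on nothing unproved).  Self-contained: it imports
only this route's thesis file (route files are never imported together).
-/

noncomputable section

namespace Summit.HodgeConjecture.HodgeConjecture.Theorems

/-- **Item stmt-HodgeConjecture-1943 (`HodgeModels`), `NodalSupport` copy**: every smooth projective
complex variety has a Hodge model — `∀ n X, nonempty_hodgeModel n X` — by the Literature discharge
`nonempty_hodgeModel_holds` (Serre GAGA §2: analytification; de Rham; Voisin (2002) §6.1.3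
Prop. 6.11: Hodge decomposition of compact Kähler manifolds).  The type is literally the route decl
`Summit.HodgeConjecture.HodgeConjecture.Theses.NodalSupport.HodgeModels`.
[cite: SerreGAGA1956, §2 n°5 Prop. 2 and n°7 Prop. 6]
[cite: VoisinHodgeI2002, §3.3.2 and §6.1.3 Prop. 6.11] -/
theorem nodalSupport_hodgeModels_proof :
    Summit.HodgeConjecture.HodgeConjecture.Theses.NodalSupport.HodgeModels := by
  unfold Summit.HodgeConjecture.HodgeConjecture.Theses.NodalSupport.HodgeModels
  exact fun n X ↦ Literature.AlgebraicGeometry.HodgeTheory.nonempty_hodgeModel_holds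

end Summit.HodgeConjecture.HodgeConjecture.Theorems

end
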